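import Literature.NumberTheory.Sieve.FriedlanderIwaniecPrimesJacobiTwistedBilinearClasses
import HarnessLib

/-!
# Friedlander–Iwaniec, *The polynomial `X² + Y⁴` captures its primes*, §12: the core bound of
# Proposition 11.1* (one `ρ`, modulus `dm`, symbol `(d/(r₁r₂))`)

[FI, §12, Proposition 11.1* and its proof, pp. 45–46 of arXiv:math/9811185; Ann. of Math. 148 (1998)
945–1040]: "To handle the extra modulus `m` we write `ℓ = dm` and note that `(r₁r₂, m) = 1`, so that we can
separate `(d/(r₁r₂)) = (m/(r₁r₂))(ℓ/(r₁r₂))`, and then transfer `(m/(r₁r₂))` to the coefficients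
`α_{r₁s₁} β_{r₂s₂}`. The new modulus `ℓ` runs over the segment `mD < ℓ ≤ 2mD` and satisfies `ℓ ≡ 0 (mod m)`
but we shall ignore the latter property by positivity. […] If we denote, for a given `ρ`, the above inner
multiple sum by `L(α, β)` then, on applying Cauchy's inequality, `L²(α, β) ≤ L(α, α)L(β, β)`. Now,
Proposition 11.1 is applicable to `L(α, α)` […]. Similarly `L(β, β)`."

This file PROVES exactly that chain for ONE value of `ρ`, i.e. Proposition 11.1* WITHOUT the side
condition `(r₁, r₂) = 1` (whose removal by Möbius inversion and the final sum over `ρ` — which produces the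
`log 2R` of `𝓜` — are the remaining steps of the printed proof):

* `jacobiSym_mod_mul_eq` — `(m/r)(dm/r) = (d/r)` for `(r, m) = 1` (the symbol transfer);
* `bilinearCongr_term_eq` — termwise: `[dm ∣ r₁s₂ − r₂s₁] α_{r₁s₁} β̄_{r₂s₂} (d/(r₁r₂))` is the
  class-encoded term `[(r₁,ℓ) = (r₂,ℓ) = 1, ℓ ∣ r₁s₂ − r₂s₁] x_{r₁s₁} ȳ_{r₂s₂}` with
  `x = α·(m/r)·(ℓ/r)`, `y = β·(m/r)·(ℓ/r)`, `ℓ = dm` (terms with `(rᵢ, d) > 1` vanish on both sides);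
* `exists_bilinearCongr_le` — **the bound**: for every `ε > 0` there is `C > 0` (the constant of the
  tree's Proposition 11.1, `exists_jtV_le`/`exists_jtVflip_le`) such that for all `m, D, R, S ≥ 1` and all
  `α, β` supported on odd `r` coprime to `m`,
  `∑_{D<d≤2D} |∑_{r₁s₂ ≡ r₂s₁ (mod dm)} α_{r₁s₁} β̄_{r₂s₂} (d/(r₁r₂))|`
  `≤ 4C {RS (mD)^{-1/2} + (mD √(RS) + RS^{3/4} + SR^{3/4})(RS)^ε} ‖α‖ ‖β‖`
  — the bilinear form is rewritten class-by-class (`bilinear_congr_eq_sum_classes`), Cauchy's inequality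
  over `(ℓ, a)` (`sum_norm_sum_mul_conj_le`), the moduli `ℓ = dm` are embedded into `(mD, 2mD]` by
  positivity, and the flipped Proposition 11.1 (`exists_jtVflip_le`) bounds `L(α,α)`, `L(β,β)`;
* `exists_bilinearCongr_four_le` — the same for vectors on a range `R' < r ≤ 4R'` (the shape met after
  the substitution `r = ρr'` in the proof of Proposition 11.1*: `R/ρ < r' ≤ 2R/ρ` lies in `(R', 4R']`,
  `R' = ⌊R/ρ⌋`), with `8C(𝓜♭(mD,R',S) + 𝓜♭(mD,2R',S))`: the `r`-range is split into two dyadic boxes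
  inside the squares.

The support hypothesis `(r, m) = 1` is the one the printed proof uses silently ("note that
`(r₁r₂, m) = 1`"); in the application (12.15) it holds because the symbol there vanishes otherwise
(HOME/parity-ideate-lit/FI98-Prop121-MAP.md, addendum (i)).  Oddness of `r` is (12.1).
No definitions, no named facts.
-/

noncomputable section

open Finset Real Complex
open scoped NumberTheorySymbols ComplexConjugate

namespace Literature.NumberTheory.Sieve.FriedlanderIwaniecPrimes

/-! ### Symbol bookkeeping -/

/-- **The symbol transfer** `(m/r)(ℓ/r) = (d/r)` for `ℓ = dm` and `(r, m) = 1` (since `(m/r)² = 1`).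
[cite: FriedlanderIwaniecAnnals1998, §12, proof of Proposition 11.1*] -/
theorem jacobiSym_mod_mul_eq {m r : ℕ} (d : ℕ) (hr : r.Coprime m) :
    J((m : ℤ) | r) * J(((d * m : ℕ) : ℤ) | r) = J((d : ℤ) | r) := by
  have hsq : J((m : ℤ) | r) ^ 2 = 1 :=
    jacobiSym.sq_one (by rw [Int.gcd_natCast_natCast]; exact Nat.Coprime.symm hr)
  rw [Nat.cast_mul, jacobiSym.mul_left]
  linear_combination (J((d : ℤ) | r)) * hsq

/-- `|(a/b)| ≤ 1` in `ℂ`. [folklore] -/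
private theorem norm_jacobiSym_le_one (a : ℤ) (b : ℕ) : ‖(J(a | b) : ℂ)‖ ≤ 1 := by
  rcases jacobiSym.trichotomy a b with h | h | h <;> simp [h]

/-- An odd natural number is nonzero. [folklore] -/
private theorem ne_zero_of_odd {r : ℕ} (h : Odd r) : r ≠ 0 := by
  obtain ⟨k, hk⟩ := h
  omega

/-- **Termwise rewriting of the bilinear form of Proposition 11.1*.** For `ℓ = dm` and
vectors `α, β` supported on odd `r` coprime to `m`:
`[ℓ ∣ r₁s₂ − r₂s₁] α_{r₁s₁} β̄_{r₂s₂} (d/(r₁r₂)) = [(r₁,ℓ)=(r₂,ℓ)=1, ℓ ∣ r₁s₂ − r₂s₁] x_{r₁s₁} ȳ_{r₂s₂}`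
with `x_{rs} = α_{rs}(m/r)(ℓ/r)`, `y_{rs} = β_{rs}(m/r)(ℓ/r)`.
[cite: FriedlanderIwaniecAnnals1998, §12, proof of Proposition 11.1*] -/
theorem bilinearCongr_term_eq {m d : ℕ} {α β : ℕ → ℕ → ℂ}
    (hα : ∀ r s, α r s ≠ 0 → Odd r ∧ r.Coprime m) (hβ : ∀ r s, β r s ≠ 0 → Odd r ∧ r.Coprime m)
    (r₁ s₁ r₂ s₂ : ℕ) :
    (if ((d * m : ℕ) : ℤ) ∣ (r₁ : ℤ) * s₂ - (r₂ : ℤ) * s₁ then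
        α r₁ s₁ * conj (β r₂ s₂) * (J((d : ℤ) | r₁ * r₂) : ℂ) else 0) =
      (if r₁.Coprime (d * m) ∧ r₂.Coprime (d * m) ∧
          ((d * m : ℕ) : ℤ) ∣ (r₁ : ℤ) * s₂ - (r₂ : ℤ) * s₁ then
        (α r₁ s₁ * J((m : ℤ) | r₁) * J(((d * m : ℕ) : ℤ) | r₁)) *
          conj (β r₂ s₂ * J((m : ℤ) | r₂) * J(((d * m : ℕ) : ℤ) | r₂)) else 0) := by
  by_cases h1 : α r₁ s₁ = 0
  · simp [h1]
  by_cases h2 : β r₂ s₂ = 0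
  · simp [h2]
  obtain ⟨ho1, hc1⟩ := hα r₁ s₁ h1
  obtain ⟨ho2, hc2⟩ := hβ r₂ s₂ h2
  have hr1 : r₁ ≠ 0 := ne_zero_of_odd ho1
  have hr2 : r₂ ≠ 0 := ne_zero_of_odd ho2
  by_cases hcop : r₁.Coprime (d * m) ∧ r₂.Coprime (d * m)
  · obtain ⟨hc1', hc2'⟩ := hcop
    rcases em (((d * m : ℕ) : ℤ) ∣ (r₁ : ℤ) * s₂ - (r₂ : ℤ) * s₁) with hdiv | hdiv
    · rw [if_pos hdiv, if_pos ⟨hc1', hc2', hdiv⟩]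
      have e1 : ((J((d : ℤ) | r₁) : ℤ) : ℂ) =
          (J((m : ℤ) | r₁) : ℂ) * (J(((d * m : ℕ) : ℤ) | r₁) : ℂ) := by
        rw [← jacobiSym_mod_mul_eq d hc1, Int.cast_mul]
      have e2 : ((J((d : ℤ) | r₂) : ℤ) : ℂ) =
          (J((m : ℤ) | r₂) : ℂ) * (J(((d * m : ℕ) : ℤ) | r₂) : ℂ) := by
        rw [← jacobiSym_mod_mul_eq d hc2, Int.cast_mul]
      rw [jacobiSym.mul_right' _ hr1 hr2, Int.cast_mul, e1, e2]
      simp only [map_mul, map_intCast]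
      ring
    · rw [if_neg hdiv, if_neg (fun h => hdiv h.2.2)]
  · rw [if_neg (show ¬(r₁.Coprime (d * m) ∧ r₂.Coprime (d * m) ∧
        ((d * m : ℕ) : ℤ) ∣ (r₁ : ℤ) * s₂ - (r₂ : ℤ) * s₁) from fun h => hcop ⟨h.1, h.2.1⟩)]
    rcases em (((d * m : ℕ) : ℤ) ∣ (r₁ : ℤ) * s₂ - (r₂ : ℤ) * s₁) with hdiv | hdiv
    · rw [if_pos hdiv]
      have hJ : J((d : ℤ) | r₁ * r₂) = 0 := by
        rw [jacobiSym.eq_zero_iff]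
        refine ⟨mul_ne_zero hr1 hr2, fun hg => hcop ?_⟩
        rw [Int.gcd_natCast_natCast] at hg
        have hg' : Nat.Coprime d (r₁ * r₂) := hg
        exact ⟨Nat.Coprime.mul_right (Nat.Coprime.coprime_dvd_right (dvd_mul_right r₁ r₂) hg').symm hc1,
          Nat.Coprime.mul_right (Nat.Coprime.coprime_dvd_right (dvd_mul_left r₂ r₁) hg').symm hc2⟩
      simp [hJ]
    · rw [if_neg hdiv]

/-! ### Embedding the moduli `ℓ = dm` into `(mD, 2mD]` -/

/-- Positivity step "we shall ignore the property `ℓ ≡ 0 (mod m)`": for `g ≥ 0` and `m ≥ 1`,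
`∑_{D<d≤2D} g(dm) ≤ ∑_{mD<ℓ≤2mD} g(ℓ)`. [cite: FriedlanderIwaniecAnnals1998, §12, proof of Proposition 11.1*] -/
theorem sum_Ioc_comp_mul_le {m D : ℕ} (hm : 1 ≤ m) {g : ℕ → ℝ} (hg : ∀ ℓ, 0 ≤ g ℓ) :
    ∑ d ∈ Ioc D (2 * D), g (d * m) ≤ ∑ ℓ ∈ Ioc (m * D) (2 * (m * D)), g ℓ := by
  have hinj : ∀ x ∈ Ioc D (2 * D), ∀ y ∈ Ioc D (2 * D), x * m = y * m → x = y :=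
    fun x _ y _ h => Nat.eq_of_mul_eq_mul_right (by omega) h
  rw [← sum_image hinj]
  refine sum_le_sum_of_subset_of_nonneg (fun ℓ hℓ => ?_) fun ℓ _ _ => hg ℓ
  rw [mem_image] at hℓ
  obtain ⟨d, hd, rfl⟩ := hℓ
  rw [mem_Ioc] at hd ⊢
  constructor <;> nlinarith [hd.1, hd.2]

/-! ### The bound -/

/-- The twisted vector `α'_{rs} = α_{rs}(m/r)` has `‖α'‖ ≤ ‖α‖`. [folklore] -/
private theorem sum_norm_sq_mul_jacobiSym_le (Rs Ss : Finset ℕ) (α : ℕ → ℕ → ℂ) (m : ℕ) :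
    ∑ r ∈ Rs, ∑ s ∈ Ss, ‖α r s * (J((m : ℤ) | r) : ℂ)‖ ^ 2 ≤ ∑ r ∈ Rs, ∑ s ∈ Ss, ‖α r s‖ ^ 2 := by
  refine sum_le_sum fun r _ => sum_le_sum fun s _ => ?_
  rw [norm_mul]
  have h1 := norm_jacobiSym_le_one (m : ℤ) r
  have h0 : 0 ≤ ‖α r s‖ := norm_nonneg _
  exact pow_le_pow_left₀ (by positivity) (mul_le_of_le_one_right h0 h1) 2

set_option maxHeartbeats 400000 in
/-- **Proposition 11.1*, core bound (one `ρ`; no condition `(r₁, r₂) = 1`).**  For every `ε > 0` there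
is `C > 0` such that for all `m, D, R, S ≥ 1` and all complex `α_{rs}, β_{rs}` on the box
`R < r ≤ 2R`, `S < s ≤ 2S`, supported on odd `r` coprime to `m`,
`∑_{D<d≤2D} |∑_{r₁s₂ ≡ r₂s₁ (mod dm)} α_{r₁s₁} β̄_{r₂s₂} (d/(r₁r₂))|`
`≤ 4C {RS (mD)^{-1/2} + (mD√(RS) + RS^{3/4} + SR^{3/4})(RS)^ε} ‖α‖ ‖β‖`.
(FI's `𝓜(mD, R, S)` without the `log 2R`, which only enters through the sum over `ρ` in the full
Proposition 11.1*.) [cite: FriedlanderIwaniecAnnals1998, Proposition 11.1* (proof, §12)] -/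
theorem exists_bilinearCongr_le {ε : ℝ} (hε : 0 < ε) :
    ∃ C : ℝ, 0 < C ∧ ∀ (m D R S : ℕ) (α β : ℕ → ℕ → ℂ), 1 ≤ m → 1 ≤ D → 1 ≤ R → 1 ≤ S →
      (∀ r s, α r s ≠ 0 → Odd r ∧ r.Coprime m) → (∀ r s, β r s ≠ 0 → Odd r ∧ r.Coprime m) →
      ∑ d ∈ Ioc D (2 * D), ‖∑ r₁ ∈ Ioc R (2 * R), ∑ s₁ ∈ Ioc S (2 * S),
          ∑ r₂ ∈ Ioc R (2 * R), ∑ s₂ ∈ Ioc S (2 * S),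
          (if ((d * m : ℕ) : ℤ) ∣ (r₁ : ℤ) * s₂ - (r₂ : ℤ) * s₁ then
            α r₁ s₁ * conj (β r₂ s₂) * (J((d : ℤ) | r₁ * r₂) : ℂ) else 0)‖ ≤
        4 * C * ((R : ℝ) * S / Real.sqrt ((m : ℝ) * D) +
          ((m : ℝ) * D * Real.sqrt ((R : ℝ) * S) + (R : ℝ) * (S : ℝ) ^ (3 / 4 : ℝ) +
            (S : ℝ) * (R : ℝ) ^ (3 / 4 : ℝ)) * ((R : ℝ) * S) ^ ε) *
          (Real.sqrt (∑ r ∈ Ioc R (2 * R), ∑ s ∈ Ioc S (2 * S), ‖α r s‖ ^ 2) *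
            Real.sqrt (∑ r ∈ Ioc R (2 * R), ∑ s ∈ Ioc S (2 * S), ‖β r s‖ ^ 2)) := by
  obtain ⟨C, hC, hV⟩ := exists_jtVflip_le hε
  refine ⟨C, hC, fun m D R S α β hm hD hR hS hα hβ => ?_⟩
  have hm0 : m ≠ 0 := by omega
  -- the class sums `G x ℓ a = ∑_{(r,ℓ)=1, s ≡ ar (ℓ)} x_{rs} (m/r) (ℓ/r)`
  have hstep1 : ∀ d ∈ Ioc D (2 * D),
      (∑ r₁ ∈ Ioc R (2 * R), ∑ s₁ ∈ Ioc S (2 * S), ∑ r₂ ∈ Ioc R (2 * R), ∑ s₂ ∈ Ioc S (2 * S),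
        (if ((d * m : ℕ) : ℤ) ∣ (r₁ : ℤ) * s₂ - (r₂ : ℤ) * s₁ then
          α r₁ s₁ * conj (β r₂ s₂) * (J((d : ℤ) | r₁ * r₂) : ℂ) else 0)) =
      ∑ a ∈ range (d * m),
        (∑ r ∈ Ioc R (2 * R), ∑ s ∈ Ioc S (2 * S),
          if r.Coprime (d * m) ∧ ((d * m : ℕ) : ℤ) ∣ (s : ℤ) - (a : ℤ) * r then
            α r s * J((m : ℤ) | r) * J(((d * m : ℕ) : ℤ) | r) else 0) *
        conj (∑ r ∈ Ioc R (2 * R), ∑ s ∈ Ioc S (2 * S),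
          if r.Coprime (d * m) ∧ ((d * m : ℕ) : ℤ) ∣ (s : ℤ) - (a : ℤ) * r then
            β r s * J((m : ℤ) | r) * J(((d * m : ℕ) : ℤ) | r) else 0) := by
    intro d hd
    have hd0 : d ≠ 0 := by rw [mem_Ioc] at hd; omega
    have hdm : 0 < d * m := Nat.pos_of_ne_zero (mul_ne_zero hd0 hm0)
    rw [bilinear_congr_eq_sum_classes hdm (Ioc R (2 * R)) (Ioc S (2 * S))
      (fun r s => α r s * J((m : ℤ) | r) * J(((d * m : ℕ) : ℤ) | r))
      (fun r s => β r s * J((m : ℤ) | r) * J(((d * m : ℕ) : ℤ) | r))]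
    refine sum_congr rfl fun r₁ _ => sum_congr rfl fun s₁ _ => sum_congr rfl fun r₂ _ =>
      sum_congr rfl fun s₂ _ => ?_
    exact bilinearCongr_term_eq hα hβ r₁ s₁ r₂ s₂
  -- Step 2: Cauchy's inequality over `(d, a)`
  have hstep2 := sum_norm_sum_mul_conj_le (Ioc D (2 * D)) (fun d => range (d * m))
    (fun d a => ∑ r ∈ Ioc R (2 * R), ∑ s ∈ Ioc S (2 * S),
      if r.Coprime (d * m) ∧ ((d * m : ℕ) : ℤ) ∣ (s : ℤ) - (a : ℤ) * r then
        α r s * J((m : ℤ) | r) * J(((d * m : ℕ) : ℤ) | r) else 0)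
    (fun d a => ∑ r ∈ Ioc R (2 * R), ∑ s ∈ Ioc S (2 * S),
      if r.Coprime (d * m) ∧ ((d * m : ℕ) : ℤ) ∣ (s : ℤ) - (a : ℤ) * r then
        β r s * J((m : ℤ) | r) * J(((d * m : ℕ) : ℤ) | r) else 0)
  -- Step 3: embed `ℓ = dm` into `(mD, 2mD]` and apply the flipped Proposition 11.1
  have hmD : 1 ≤ m * D := Nat.one_le_iff_ne_zero.mpr (mul_ne_zero hm0 (by omega))
  have hcast : ((m * D : ℕ) : ℝ) = (m : ℝ) * D := by push_cast; ring
  have hK0 : 0 ≤ 4 * C * ((R : ℝ) * S / Real.sqrt ((m : ℝ) * D) +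
      ((m : ℝ) * D * Real.sqrt ((R : ℝ) * S) + (R : ℝ) * (S : ℝ) ^ (3 / 4 : ℝ) +
        (S : ℝ) * (R : ℝ) ^ (3 / 4 : ℝ)) * ((R : ℝ) * S) ^ ε) := by positivity
  have hbound : ∀ x : ℕ → ℕ → ℂ, (∀ r s, x r s ≠ 0 → Odd r ∧ r.Coprime m) →
      ∑ d ∈ Ioc D (2 * D), ∑ a ∈ range (d * m), ‖∑ r ∈ Ioc R (2 * R), ∑ s ∈ Ioc S (2 * S),
          (if r.Coprime (d * m) ∧ ((d * m : ℕ) : ℤ) ∣ (s : ℤ) - (a : ℤ) * r then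
            x r s * J((m : ℤ) | r) * J(((d * m : ℕ) : ℤ) | r) else 0)‖ ^ 2 ≤
        4 * C * ((R : ℝ) * S / Real.sqrt ((m : ℝ) * D) +
          ((m : ℝ) * D * Real.sqrt ((R : ℝ) * S) + (R : ℝ) * (S : ℝ) ^ (3 / 4 : ℝ) +
            (S : ℝ) * (R : ℝ) ^ (3 / 4 : ℝ)) * ((R : ℝ) * S) ^ ε) *
          ∑ r ∈ Ioc R (2 * R), ∑ s ∈ Ioc S (2 * S), ‖x r s‖ ^ 2 := by
    intro x hx
    have hodd : ∀ r s, x r s * (J((m : ℤ) | r) : ℂ) ≠ 0 → Odd r := by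
      intro r s h
      exact (hx r s (left_ne_zero_of_mul h)).1
    have hVx := hV (m * D) R S (fun r s => x r s * J((m : ℤ) | r)) hmD hR hS hodd
    simp only [hcast] at hVx
    calc ∑ d ∈ Ioc D (2 * D), ∑ a ∈ range (d * m), ‖∑ r ∈ Ioc R (2 * R), ∑ s ∈ Ioc S (2 * S),
          (if r.Coprime (d * m) ∧ ((d * m : ℕ) : ℤ) ∣ (s : ℤ) - (a : ℤ) * r then
            x r s * J((m : ℤ) | r) * J(((d * m : ℕ) : ℤ) | r) else 0)‖ ^ 2
        ≤ ∑ ℓ ∈ Ioc (m * D) (2 * (m * D)), ∑ a ∈ range ℓ,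
            ‖∑ r ∈ Ioc R (2 * R), ∑ s ∈ Ioc S (2 * S),
              (if r.Coprime ℓ ∧ (ℓ : ℤ) ∣ (s : ℤ) - (a : ℤ) * r then
                x r s * J((m : ℤ) | r) * J((ℓ : ℤ) | r) else 0)‖ ^ 2 :=
          sum_Ioc_comp_mul_le (g := fun ℓ => ∑ a ∈ range ℓ,
            ‖∑ r ∈ Ioc R (2 * R), ∑ s ∈ Ioc S (2 * S),
              (if r.Coprime ℓ ∧ (ℓ : ℤ) ∣ (s : ℤ) - (a : ℤ) * r then
                x r s * J((m : ℤ) | r) * J((ℓ : ℤ) | r) else 0)‖ ^ 2) hm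
            (fun ℓ => sum_nonneg fun _ _ => by positivity)
      _ ≤ 4 * C * ((R : ℝ) * S / Real.sqrt ((m : ℝ) * D) +
            ((m : ℝ) * D * Real.sqrt ((R : ℝ) * S) + (R : ℝ) * (S : ℝ) ^ (3 / 4 : ℝ) +
              (S : ℝ) * (R : ℝ) ^ (3 / 4 : ℝ)) * ((R : ℝ) * S) ^ ε) *
            ∑ r ∈ Ioc R (2 * R), ∑ s ∈ Ioc S (2 * S), ‖x r s * (J((m : ℤ) | r) : ℂ)‖ ^ 2 := hVx
      _ ≤ _ := mul_le_mul_of_nonneg_left (sum_norm_sq_mul_jacobiSym_le _ _ x m) hK0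
  -- Step 4: assembly
  have hA := hbound α hα
  have hB := hbound β hβ
  calc ∑ d ∈ Ioc D (2 * D), ‖∑ r₁ ∈ Ioc R (2 * R), ∑ s₁ ∈ Ioc S (2 * S),
          ∑ r₂ ∈ Ioc R (2 * R), ∑ s₂ ∈ Ioc S (2 * S),
          (if ((d * m : ℕ) : ℤ) ∣ (r₁ : ℤ) * s₂ - (r₂ : ℤ) * s₁ then
            α r₁ s₁ * conj (β r₂ s₂) * (J((d : ℤ) | r₁ * r₂) : ℂ) else 0)‖
      = ∑ d ∈ Ioc D (2 * D), ‖∑ a ∈ range (d * m),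
          (∑ r ∈ Ioc R (2 * R), ∑ s ∈ Ioc S (2 * S),
            if r.Coprime (d * m) ∧ ((d * m : ℕ) : ℤ) ∣ (s : ℤ) - (a : ℤ) * r then
              α r s * J((m : ℤ) | r) * J(((d * m : ℕ) : ℤ) | r) else 0) *
          conj (∑ r ∈ Ioc R (2 * R), ∑ s ∈ Ioc S (2 * S),
            if r.Coprime (d * m) ∧ ((d * m : ℕ) : ℤ) ∣ (s : ℤ) - (a : ℤ) * r then
              β r s * J((m : ℤ) | r) * J(((d * m : ℕ) : ℤ) | r) else 0)‖ :=
        sum_congr rfl fun d hd => by rw [hstep1 d hd]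
    _ ≤ _ := hstep2
    _ ≤ Real.sqrt (4 * C * ((R : ℝ) * S / Real.sqrt ((m : ℝ) * D) +
            ((m : ℝ) * D * Real.sqrt ((R : ℝ) * S) + (R : ℝ) * (S : ℝ) ^ (3 / 4 : ℝ) +
              (S : ℝ) * (R : ℝ) ^ (3 / 4 : ℝ)) * ((R : ℝ) * S) ^ ε) *
            ∑ r ∈ Ioc R (2 * R), ∑ s ∈ Ioc S (2 * S), ‖α r s‖ ^ 2) *
          Real.sqrt (4 * C * ((R : ℝ) * S / Real.sqrt ((m : ℝ) * D) +
            ((m : ℝ) * D * Real.sqrt ((R : ℝ) * S) + (R : ℝ) * (S : ℝ) ^ (3 / 4 : ℝ) +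
              (S : ℝ) * (R : ℝ) ^ (3 / 4 : ℝ)) * ((R : ℝ) * S) ^ ε) *
            ∑ r ∈ Ioc R (2 * R), ∑ s ∈ Ioc S (2 * S), ‖β r s‖ ^ 2) := by
        gcongr
    _ = _ := by
        rw [Real.sqrt_mul hK0, Real.sqrt_mul hK0]
        have h := Real.mul_self_sqrt hK0
        set K := 4 * C * ((R : ℝ) * S / Real.sqrt ((m : ℝ) * D) +
          ((m : ℝ) * D * Real.sqrt ((R : ℝ) * S) + (R : ℝ) * (S : ℝ) ^ (3 / 4 : ℝ) +
            (S : ℝ) * (R : ℝ) ^ (3 / 4 : ℝ)) * ((R : ℝ) * S) ^ ε)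
        linear_combination (Real.sqrt (∑ r ∈ Ioc R (2 * R), ∑ s ∈ Ioc S (2 * S), ‖α r s‖ ^ 2) *
          Real.sqrt (∑ r ∈ Ioc R (2 * R), ∑ s ∈ Ioc S (2 * S), ‖β r s‖ ^ 2)) * h

/-! ### The same bound for vectors living on a range `(R', 4R']`

In the proof of Proposition 11.1* the vectors `r ↦ α_{ρrs}` live on `R/ρ < r ≤ 2R/ρ`, which is not a
dyadic box `(R', 2R']` with `R' ∈ ℕ`; it is contained in `(R', 4R']` with `R' = ⌊R/ρ⌋` (when `ρ ≤ R`).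
Since `L(α, α)` is a sum of squares of linear forms in `α`, splitting the `r`-range into the two dyadic
boxes `(R', 2R'] ∪ (2R', 4R']` costs a factor `2` ("`|x + y|² ≤ 2|x|² + 2|y|²`", FI p. 43) and
Proposition 11.1 applies to each box (HOME/parity-ideate-lit/FI98-Prop121-MAP.md, addendum (iii)). -/

/-- `|∑_{R'<r≤4R'} f(r)|² ≤ 2|∑_{R'<r≤2R'} f(r)|² + 2|∑_{2R'<r≤4R'} f(r)|²`. [folklore] -/
private theorem normSq_sum_Ioc_four_le (R' : ℕ) (f : ℕ → ℂ) :
    ‖∑ r ∈ Ioc R' (2 * (2 * R')), f r‖ ^ 2 ≤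
      2 * ‖∑ r ∈ Ioc R' (2 * R'), f r‖ ^ 2 + 2 * ‖∑ r ∈ Ioc (2 * R') (2 * (2 * R')), f r‖ ^ 2 := by
  have hdisj : Disjoint (Ioc R' (2 * R')) (Ioc (2 * R') (2 * (2 * R'))) :=
    disjoint_left.2 fun r h1 h2 => by rw [mem_Ioc] at h1 h2; omega
  rw [← Ioc_union_Ioc_eq_Ioc (by omega : R' ≤ 2 * R') (by omega : 2 * R' ≤ 2 * (2 * R')),
    sum_union hdisj]
  set a := ∑ r ∈ Ioc R' (2 * R'), f r
  set b := ∑ r ∈ Ioc (2 * R') (2 * (2 * R')), f r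
  have h2 : ‖a + b‖ ^ 2 ≤ (‖a‖ + ‖b‖) ^ 2 := pow_le_pow_left₀ (norm_nonneg _) (norm_add_le a b) 2
  nlinarith [sq_nonneg (‖a‖ - ‖b‖), h2]

set_option maxHeartbeats 400000 in
/-- **Proposition 11.1*, core bound, sub-box version.**  As `exists_bilinearCongr_le`, for vectors
`α, β` supported on odd `r` coprime to `m` in the range `R' < r ≤ 4R'` (sums over that range): the bound
holds with `8C (𝓜♭(mD, R', S) + 𝓜♭(mD, 2R', S))` in place of `4C 𝓜♭(mD, R, S)`, by splitting
`(R', 4R'] = (R', 2R'] ∪ (2R', 4R']` inside the squares of `L(α,α)`, `L(β,β)`.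
[cite: FriedlanderIwaniecAnnals1998, Proposition 11.1* (proof, §12)] -/
theorem exists_bilinearCongr_four_le {ε : ℝ} (hε : 0 < ε) :
    ∃ C : ℝ, 0 < C ∧ ∀ (m D R' S : ℕ) (α β : ℕ → ℕ → ℂ), 1 ≤ m → 1 ≤ D → 1 ≤ R' → 1 ≤ S →
      (∀ r s, α r s ≠ 0 → Odd r ∧ r.Coprime m) → (∀ r s, β r s ≠ 0 → Odd r ∧ r.Coprime m) →
      ∑ d ∈ Ioc D (2 * D), ‖∑ r₁ ∈ Ioc R' (2 * (2 * R')), ∑ s₁ ∈ Ioc S (2 * S),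
          ∑ r₂ ∈ Ioc R' (2 * (2 * R')), ∑ s₂ ∈ Ioc S (2 * S),
          (if ((d * m : ℕ) : ℤ) ∣ (r₁ : ℤ) * s₂ - (r₂ : ℤ) * s₁ then
            α r₁ s₁ * conj (β r₂ s₂) * (J((d : ℤ) | r₁ * r₂) : ℂ) else 0)‖ ≤
        8 * C * (((R' : ℝ) * S / Real.sqrt ((m : ℝ) * D) +
            ((m : ℝ) * D * Real.sqrt ((R' : ℝ) * S) + (R' : ℝ) * (S : ℝ) ^ (3 / 4 : ℝ) +
              (S : ℝ) * (R' : ℝ) ^ (3 / 4 : ℝ)) * ((R' : ℝ) * S) ^ ε) +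
          (((2 * R' : ℕ) : ℝ) * S / Real.sqrt ((m : ℝ) * D) +
            ((m : ℝ) * D * Real.sqrt (((2 * R' : ℕ) : ℝ) * S) +
              ((2 * R' : ℕ) : ℝ) * (S : ℝ) ^ (3 / 4 : ℝ) +
              (S : ℝ) * ((2 * R' : ℕ) : ℝ) ^ (3 / 4 : ℝ)) * (((2 * R' : ℕ) : ℝ) * S) ^ ε)) *
          (Real.sqrt (∑ r ∈ Ioc R' (2 * (2 * R')), ∑ s ∈ Ioc S (2 * S), ‖α r s‖ ^ 2) *
            Real.sqrt (∑ r ∈ Ioc R' (2 * (2 * R')), ∑ s ∈ Ioc S (2 * S), ‖β r s‖ ^ 2)) := by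
  obtain ⟨C, hC, hV⟩ := exists_jtVflip_le hε
  refine ⟨C, hC, fun m D R' S α β hm hD hR hS hα hβ => ?_⟩
  have hm0 : m ≠ 0 := by omega
  have h2R : 1 ≤ 2 * R' := by omega
  -- Step 1: class encoding, as before
  have hstep1 : ∀ d ∈ Ioc D (2 * D),
      (∑ r₁ ∈ Ioc R' (2 * (2 * R')), ∑ s₁ ∈ Ioc S (2 * S), ∑ r₂ ∈ Ioc R' (2 * (2 * R')),
        ∑ s₂ ∈ Ioc S (2 * S),
        (if ((d * m : ℕ) : ℤ) ∣ (r₁ : ℤ) * s₂ - (r₂ : ℤ) * s₁ then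
          α r₁ s₁ * conj (β r₂ s₂) * (J((d : ℤ) | r₁ * r₂) : ℂ) else 0)) =
      ∑ a ∈ range (d * m),
        (∑ r ∈ Ioc R' (2 * (2 * R')), ∑ s ∈ Ioc S (2 * S),
          if r.Coprime (d * m) ∧ ((d * m : ℕ) : ℤ) ∣ (s : ℤ) - (a : ℤ) * r then
            α r s * J((m : ℤ) | r) * J(((d * m : ℕ) : ℤ) | r) else 0) *
        conj (∑ r ∈ Ioc R' (2 * (2 * R')), ∑ s ∈ Ioc S (2 * S),
          if r.Coprime (d * m) ∧ ((d * m : ℕ) : ℤ) ∣ (s : ℤ) - (a : ℤ) * r then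
            β r s * J((m : ℤ) | r) * J(((d * m : ℕ) : ℤ) | r) else 0) := by
    intro d hd
    have hd0 : d ≠ 0 := by rw [mem_Ioc] at hd; omega
    have hdm : 0 < d * m := Nat.pos_of_ne_zero (mul_ne_zero hd0 hm0)
    rw [bilinear_congr_eq_sum_classes hdm (Ioc R' (2 * (2 * R'))) (Ioc S (2 * S))
      (fun r s => α r s * J((m : ℤ) | r) * J(((d * m : ℕ) : ℤ) | r))
      (fun r s => β r s * J((m : ℤ) | r) * J(((d * m : ℕ) : ℤ) | r))]
    refine sum_congr rfl fun r₁ _ => sum_congr rfl fun s₁ _ => sum_congr rfl fun r₂ _ =>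
      sum_congr rfl fun s₂ _ => ?_
    exact bilinearCongr_term_eq hα hβ r₁ s₁ r₂ s₂
  -- Step 2: Cauchy's inequality over `(d, a)`
  have hstep2 := sum_norm_sum_mul_conj_le (Ioc D (2 * D)) (fun d => range (d * m))
    (fun d a => ∑ r ∈ Ioc R' (2 * (2 * R')), ∑ s ∈ Ioc S (2 * S),
      if r.Coprime (d * m) ∧ ((d * m : ℕ) : ℤ) ∣ (s : ℤ) - (a : ℤ) * r then
        α r s * J((m : ℤ) | r) * J(((d * m : ℕ) : ℤ) | r) else 0)
    (fun d a => ∑ r ∈ Ioc R' (2 * (2 * R')), ∑ s ∈ Ioc S (2 * S),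
      if r.Coprime (d * m) ∧ ((d * m : ℕ) : ℤ) ∣ (s : ℤ) - (a : ℤ) * r then
        β r s * J((m : ℤ) | r) * J(((d * m : ℕ) : ℤ) | r) else 0)
  -- Step 3: embed `ℓ = dm`, split the `r`-range, apply the flipped Proposition 11.1 twice
  have hmD : 1 ≤ m * D := Nat.one_le_iff_ne_zero.mpr (mul_ne_zero hm0 (by omega))
  have hcast : ((m * D : ℕ) : ℝ) = (m : ℝ) * D := by push_cast; ring
  set M₁ : ℝ := (R' : ℝ) * S / Real.sqrt ((m : ℝ) * D) +
    ((m : ℝ) * D * Real.sqrt ((R' : ℝ) * S) + (R' : ℝ) * (S : ℝ) ^ (3 / 4 : ℝ) +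
      (S : ℝ) * (R' : ℝ) ^ (3 / 4 : ℝ)) * ((R' : ℝ) * S) ^ ε with hM₁
  set M₂ : ℝ := ((2 * R' : ℕ) : ℝ) * S / Real.sqrt ((m : ℝ) * D) +
    ((m : ℝ) * D * Real.sqrt (((2 * R' : ℕ) : ℝ) * S) + ((2 * R' : ℕ) : ℝ) * (S : ℝ) ^ (3 / 4 : ℝ) +
      (S : ℝ) * ((2 * R' : ℕ) : ℝ) ^ (3 / 4 : ℝ)) * (((2 * R' : ℕ) : ℝ) * S) ^ ε with hM₂
  have hM₁0 : 0 ≤ M₁ := by positivity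
  have hM₂0 : 0 ≤ M₂ := by positivity
  have hK0 : 0 ≤ 8 * C * (M₁ + M₂) := by positivity
  have hbound : ∀ x : ℕ → ℕ → ℂ, (∀ r s, x r s ≠ 0 → Odd r ∧ r.Coprime m) →
      ∑ d ∈ Ioc D (2 * D), ∑ a ∈ range (d * m), ‖∑ r ∈ Ioc R' (2 * (2 * R')), ∑ s ∈ Ioc S (2 * S),
          (if r.Coprime (d * m) ∧ ((d * m : ℕ) : ℤ) ∣ (s : ℤ) - (a : ℤ) * r then
            x r s * J((m : ℤ) | r) * J(((d * m : ℕ) : ℤ) | r) else 0)‖ ^ 2 ≤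
        8 * C * (M₁ + M₂) * ∑ r ∈ Ioc R' (2 * (2 * R')), ∑ s ∈ Ioc S (2 * S), ‖x r s‖ ^ 2 := by
    intro x hx
    have hodd : ∀ r s, x r s * (J((m : ℤ) | r) : ℂ) ≠ 0 → Odd r := by
      intro r s h
      exact (hx r s (left_ne_zero_of_mul h)).1
    have hV₁ := hV (m * D) R' S (fun r s => x r s * J((m : ℤ) | r)) hmD hR hS hodd
    have hV₂ := hV (m * D) (2 * R') S (fun r s => x r s * J((m : ℤ) | r)) hmD h2R hS hodd
    simp only [hcast] at hV₁ hV₂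
    rw [← hM₁] at hV₁
    rw [← hM₂] at hV₂
    have hN₁ := sum_norm_sq_mul_jacobiSym_le (Ioc R' (2 * R')) (Ioc S (2 * S)) x m
    have hN₂ := sum_norm_sq_mul_jacobiSym_le (Ioc (2 * R') (2 * (2 * R'))) (Ioc S (2 * S)) x m
    have hdisj : Disjoint (Ioc R' (2 * R')) (Ioc (2 * R') (2 * (2 * R'))) :=
      disjoint_left.2 fun r h1 h2 => by rw [mem_Ioc] at h1 h2; omega
    have hsplitN : ∑ r ∈ Ioc R' (2 * (2 * R')), ∑ s ∈ Ioc S (2 * S), ‖x r s‖ ^ 2 =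
        ∑ r ∈ Ioc R' (2 * R'), ∑ s ∈ Ioc S (2 * S), ‖x r s‖ ^ 2 +
          ∑ r ∈ Ioc (2 * R') (2 * (2 * R')), ∑ s ∈ Ioc S (2 * S), ‖x r s‖ ^ 2 := by
      rw [← sum_union hdisj, Ioc_union_Ioc_eq_Ioc (by omega) (by omega)]
    have hNn₁ : 0 ≤ ∑ r ∈ Ioc R' (2 * R'), ∑ s ∈ Ioc S (2 * S), ‖x r s‖ ^ 2 := by positivity
    have hNn₂ : 0 ≤ ∑ r ∈ Ioc (2 * R') (2 * (2 * R')), ∑ s ∈ Ioc S (2 * S), ‖x r s‖ ^ 2 := by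
      positivity
    calc ∑ d ∈ Ioc D (2 * D), ∑ a ∈ range (d * m), ‖∑ r ∈ Ioc R' (2 * (2 * R')),
          ∑ s ∈ Ioc S (2 * S),
          (if r.Coprime (d * m) ∧ ((d * m : ℕ) : ℤ) ∣ (s : ℤ) - (a : ℤ) * r then
            x r s * J((m : ℤ) | r) * J(((d * m : ℕ) : ℤ) | r) else 0)‖ ^ 2
        ≤ ∑ ℓ ∈ Ioc (m * D) (2 * (m * D)), ∑ a ∈ range ℓ,
            ‖∑ r ∈ Ioc R' (2 * (2 * R')), ∑ s ∈ Ioc S (2 * S),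
              (if r.Coprime ℓ ∧ (ℓ : ℤ) ∣ (s : ℤ) - (a : ℤ) * r then
                x r s * J((m : ℤ) | r) * J((ℓ : ℤ) | r) else 0)‖ ^ 2 :=
          sum_Ioc_comp_mul_le (g := fun ℓ => ∑ a ∈ range ℓ,
            ‖∑ r ∈ Ioc R' (2 * (2 * R')), ∑ s ∈ Ioc S (2 * S),
              (if r.Coprime ℓ ∧ (ℓ : ℤ) ∣ (s : ℤ) - (a : ℤ) * r then
                x r s * J((m : ℤ) | r) * J((ℓ : ℤ) | r) else 0)‖ ^ 2) hm
            (fun ℓ => sum_nonneg fun _ _ => by positivity)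
      _ ≤ ∑ ℓ ∈ Ioc (m * D) (2 * (m * D)), ∑ a ∈ range ℓ,
            (2 * ‖∑ r ∈ Ioc R' (2 * R'), ∑ s ∈ Ioc S (2 * S),
              (if r.Coprime ℓ ∧ (ℓ : ℤ) ∣ (s : ℤ) - (a : ℤ) * r then
                x r s * J((m : ℤ) | r) * J((ℓ : ℤ) | r) else 0)‖ ^ 2 +
            2 * ‖∑ r ∈ Ioc (2 * R') (2 * (2 * R')), ∑ s ∈ Ioc S (2 * S),
              (if r.Coprime ℓ ∧ (ℓ : ℤ) ∣ (s : ℤ) - (a : ℤ) * r then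
                x r s * J((m : ℤ) | r) * J((ℓ : ℤ) | r) else 0)‖ ^ 2) :=
          sum_le_sum fun ℓ _ => sum_le_sum fun a _ => normSq_sum_Ioc_four_le R' _
      _ = 2 * (∑ ℓ ∈ Ioc (m * D) (2 * (m * D)), ∑ a ∈ range ℓ,
              ‖∑ r ∈ Ioc R' (2 * R'), ∑ s ∈ Ioc S (2 * S),
                (if r.Coprime ℓ ∧ (ℓ : ℤ) ∣ (s : ℤ) - (a : ℤ) * r then
                  x r s * J((m : ℤ) | r) * J((ℓ : ℤ) | r) else 0)‖ ^ 2) +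
          2 * (∑ ℓ ∈ Ioc (m * D) (2 * (m * D)), ∑ a ∈ range ℓ,
              ‖∑ r ∈ Ioc (2 * R') (2 * (2 * R')), ∑ s ∈ Ioc S (2 * S),
                (if r.Coprime ℓ ∧ (ℓ : ℤ) ∣ (s : ℤ) - (a : ℤ) * r then
                  x r s * J((m : ℤ) | r) * J((ℓ : ℤ) | r) else 0)‖ ^ 2) := by
          simp only [sum_add_distrib, mul_sum]
      _ ≤ 2 * (4 * C * M₁ * ∑ r ∈ Ioc R' (2 * R'), ∑ s ∈ Ioc S (2 * S),
              ‖x r s * (J((m : ℤ) | r) : ℂ)‖ ^ 2) +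
          2 * (4 * C * M₂ * ∑ r ∈ Ioc (2 * R') (2 * (2 * R')), ∑ s ∈ Ioc S (2 * S),
              ‖x r s * (J((m : ℤ) | r) : ℂ)‖ ^ 2) := by gcongr
      _ ≤ 2 * (4 * C * M₁ * ∑ r ∈ Ioc R' (2 * R'), ∑ s ∈ Ioc S (2 * S), ‖x r s‖ ^ 2) +
          2 * (4 * C * M₂ * ∑ r ∈ Ioc (2 * R') (2 * (2 * R')), ∑ s ∈ Ioc S (2 * S),
              ‖x r s‖ ^ 2) := by gcongr
      _ ≤ 8 * C * (M₁ + M₂) * ∑ r ∈ Ioc R' (2 * (2 * R')), ∑ s ∈ Ioc S (2 * S), ‖x r s‖ ^ 2 := by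
          rw [hsplitN]
          nlinarith [mul_nonneg (mul_nonneg hC.le hM₁0) hNn₂, mul_nonneg (mul_nonneg hC.le hM₂0) hNn₁]
  -- Step 4: assembly
  have hA := hbound α hα
  have hB := hbound β hβ
  calc ∑ d ∈ Ioc D (2 * D), ‖∑ r₁ ∈ Ioc R' (2 * (2 * R')), ∑ s₁ ∈ Ioc S (2 * S),
          ∑ r₂ ∈ Ioc R' (2 * (2 * R')), ∑ s₂ ∈ Ioc S (2 * S),
          (if ((d * m : ℕ) : ℤ) ∣ (r₁ : ℤ) * s₂ - (r₂ : ℤ) * s₁ then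
            α r₁ s₁ * conj (β r₂ s₂) * (J((d : ℤ) | r₁ * r₂) : ℂ) else 0)‖
      = ∑ d ∈ Ioc D (2 * D), ‖∑ a ∈ range (d * m),
          (∑ r ∈ Ioc R' (2 * (2 * R')), ∑ s ∈ Ioc S (2 * S),
            if r.Coprime (d * m) ∧ ((d * m : ℕ) : ℤ) ∣ (s : ℤ) - (a : ℤ) * r then
              α r s * J((m : ℤ) | r) * J(((d * m : ℕ) : ℤ) | r) else 0) *
          conj (∑ r ∈ Ioc R' (2 * (2 * R')), ∑ s ∈ Ioc S (2 * S),
            if r.Coprime (d * m) ∧ ((d * m : ℕ) : ℤ) ∣ (s : ℤ) - (a : ℤ) * r then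
              β r s * J((m : ℤ) | r) * J(((d * m : ℕ) : ℤ) | r) else 0)‖ :=
        sum_congr rfl fun d hd => by rw [hstep1 d hd]
    _ ≤ _ := hstep2
    _ ≤ Real.sqrt (8 * C * (M₁ + M₂) *
            ∑ r ∈ Ioc R' (2 * (2 * R')), ∑ s ∈ Ioc S (2 * S), ‖α r s‖ ^ 2) *
          Real.sqrt (8 * C * (M₁ + M₂) *
            ∑ r ∈ Ioc R' (2 * (2 * R')), ∑ s ∈ Ioc S (2 * S), ‖β r s‖ ^ 2) := by
        gcongr
    _ = _ := by
        rw [Real.sqrt_mul hK0, Real.sqrt_mul hK0]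
        have h := Real.mul_self_sqrt hK0
        linear_combination (Real.sqrt (∑ r ∈ Ioc R' (2 * (2 * R')), ∑ s ∈ Ioc S (2 * S),
          ‖α r s‖ ^ 2) * Real.sqrt (∑ r ∈ Ioc R' (2 * (2 * R')), ∑ s ∈ Ioc S (2 * S),
          ‖β r s‖ ^ 2)) * h


end Literature.NumberTheory.Sieve.FriedlanderIwaniecPrimes

end
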